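import Summits.HodgeConjecture.HodgeConjecture.Theorems.F0P3IsotypicOfCogenerated
import Summits.HodgeConjecture.HodgeConjecture.Theorems.F0P3bStubT6dAdmissibleBridge
import Literature.NumberTheory.Automorphic.GKModuleRing
import Literature.NumberTheory.Automorphic.UnitaryIsotypicProjection
import Literature.NumberTheory.Automorphic.DiscreteAutomorphicRepArchIsotypy
import HarnessLib

/-!
# Crux `H413` — F1b road, brick R2♯ (2∕2): a `(𝔤, K)`-module COGENERATED by an irreducible admissible `M` is SEMISIMPLE and
# `M`-ISOTYPIC, and `M` OCCURS in it — letter F1a's «cogeneration» currency turned into Bourbaki's isotypic currency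

Floor-0 programme P3 «U3-mult», seat F0P3-p04 (g4); crux item stmt-HodgeConjecture-24833 (`HCCMUnconditional.H413`), line of record
`Cruxes/H413/Lines/F0_U3LettersRung1.lean` (open stub `stub_F1b_cm`); census of the in-house road for letter F1b
`F0/P3/A-p02/CENSUS-F1b-inhouse-road.A-p02g18.md`, step R2.  Sequel of ★ `F0P3IsotypicOfCogenerated` (pure ring theory).
GENERIC `(𝔤, K)` ALGEBRA in §3; the automorphic instance in §4.  HC_CM is proved only modulo the printed citations until rung 0 closes.

THE POINT.  Letter F1a ★ `DiscreteAutomorphicRep.ArchIsotypy` (and its in-house discharge at the CM pin, ★ `F0P3HolFormArchIsotypy` /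
`F0P3StubF1aHolHalf` / `F0P3StubF1aCM`) hands `V = P.archModule G ι` in COGENERATION currency: an irreducible admissible `(𝔤, K)`-module
`M` such that every non-zero `v ∈ V` is detected by some `(𝔤, K)`-map `φ : V → M`, `φ v ≠ 0`.  Step R2 of the F1b road
(★ `CommutingAlgebrasSimpleModuleSplit.exists_linearEquiv_of_surjective_algebraMap` / `exists_linearEquiv_of_hom_equiv`, F0P3-p01 (g4))
consumes instead an OCCURRENCE `j : M →ₗ V`, `j ≠ 0`, and the isotypic language (Mathlib `isotypicComponent`, `IsIsotypicOfType`).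

* §3 (`(𝔤, K)`-modules of a real matrix group `G`): for a `(𝔤, K)`-module `V` (every vector `K`-finite) and an ADMISSIBLE `M`, the values
  `φ v` of all `(𝔤, K)`-maps `φ : V → M` at a fixed `v` lie in the finite-dimensional `E`-part of `M`, `E = span(K·v)`
  (`exists_finiteDimensional_forall_apply_mem`; `Hom_K(E, M)` is finite-dimensional for every finite-dimensional `K`-representation `E` by ★
  `F0P3bStubT6dAdmissibleBridge.finiteDimensional_intertwiningMap_of_irreducibles` — induction on `dim E` through subrepresentations and
  quotients, no compactness of `K` needed).  HEAD: **`isotypicComponent_eq_top_of_cogenerated`** — cogenerated (letter F1a's pointwise currency)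
  by an irreducible admissible `M` ⇒ `isotypicComponent (GKRing G) V M = ⊤` (★ `F0P3IsotypicOfCogenerated` §2 with `k = ℂ`, then §1); corollaries
  `isSemisimpleModule_of_cogenerated`, `isIsotypicOfType_of_cogenerated`, and the OCCURRENCE `exists_injective_of_cogenerated`
  (`∃ j : M →ₗ[GKRing G] V` injective, for `V ≠ 0`) = the `j ≠ 0` input of R2.
* §4 the instance for a discrete automorphic `P`: letter F1a `P.ArchIsotypy G ι` ⇒ `P.archModule G ι` is semisimple `M`-isotypic and
  `M ↪ P.archModule G ι` when the latter is non-zero (`exists_isotypic_of_archIsotypy`).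

Sources: N. Bourbaki, *Algèbre* VIII (2012), §4 n°1–2 [BourbakiAlgebreVIII2012]; A. W. Knapp, D. A. Vogan, *Cohomological Induction and
Unitary Representations* (1995), Ch. I §3 (admissible: each `K`-type has finite multiplicity) [KnappVogan1995]; N. R. Wallach, *Real Reductive Groups I* (1988), §3.3.1 [WallachRRG1].

No definition, no sorry, no named fact; `--supports stmt-HodgeConjecture-24833 --as helper`.
-/

set_option autoImplicit false
-- the mandated namespace repeats `HodgeConjecture.HodgeConjecture`, as in every `Theorems/*.lean` of this sub-problem
set_option linter.dupNamespace false

-- Mathlib idiom (as in ★ `GKModules`): commutator bracket on `Module.End` / matrices, to MENTION `G.lie →ₗ⁅ℝ⁆ Module.End ℂ _`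
attribute [local instance 100] LieRing.ofAssociativeRing

noncomputable section

namespace Summit.HodgeConjecture.HodgeConjecture.Cruxes.H413.F0P3ArchModuleIsotypic

open Literature.NumberTheory.Automorphic
open Summit.HodgeConjecture.HodgeConjecture.Cruxes.H413.F0P3IsotypicOfCogenerated

/-! ## §3 `(𝔤, K)`-modules: `K`-finiteness + admissibility give finite-dimensional values; the HEAD -/

section GK

variable {A : Type*} [NormedCommRing A] [NormedAlgebra ℝ A] [NormedAlgebra ℚ A] [CompleteSpace A]
  [StarRing A] [StarModule ℝ A] [ContinuousStar A] {N : Type*} [Fintype N] [DecidableEq N] {G : RealMatrixGroup A N}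
  {V : Type} [AddCommGroup V] [Module ℂ V]
  {ρK : Representation ℂ G.maximalCompact V} {ρ𝔤 : G.lie →ₗ⁅ℝ⁆ Module.End ℂ V}
  {M : Type} [AddCommGroup M] [Module ℂ M]
  {σK : Representation ℂ G.maximalCompact M} {σ𝔤 : G.lie →ₗ⁅ℝ⁆ Module.End ℂ M}

omit [StarModule ℝ A] [ContinuousStar A] in
/-- The span of the `K`-orbit of `v` is `K`-stable. [folklore] -/
theorem span_orbit_le_comap' (v : V) (k : G.maximalCompact) :
    Submodule.span ℂ (Set.range fun k' : G.maximalCompact => ρK k' v) ≤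
      (Submodule.span ℂ (Set.range fun k' : G.maximalCompact => ρK k' v)).comap (ρK k) := by
  rw [← Submodule.map_le_iff_le_comap, Submodule.map_span, Submodule.span_le]
  rintro _ ⟨_, ⟨k', rfl⟩, rfl⟩
  exact Submodule.subset_span ⟨k * k', by simp [map_mul]⟩

/-- **Finite-dimensional values.**  For a `(𝔤, K)`-module `V` and an ADMISSIBLE `K`-action `σK` on `M`, the values `φ v` at a fixed `v ∈ V`
of ALL `GKRing G`-linear maps `φ : V → M` lie in one finite-dimensional subspace of `M` — the `E`-part `Σ_{f ∈ Hom_K(E, M)} f(E)` of `M` for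
`E = span(K·v)` (finite-dimensional by `K`-finiteness; `Hom_K(E, M)` finite-dimensional by admissibility, ★
`F0P3bStubT6dAdmissibleBridge.finiteDimensional_intertwiningMap_of_irreducibles`; ★ `Representation.finiteDimensional_homRangeSum`).
[cite: KnappVogan1995, Ch. I §3] [cite: WallachRRG1, §3.3.1] -/
theorem exists_finiteDimensional_forall_apply_mem (hV : IsGKModule G ρK ρ𝔤) (hadm : IsAdmissibleGK σK) (v : V) :
    ∃ E' : Submodule ℂ M, FiniteDimensional ℂ E' ∧
      ∀ φ : GKRing.asModule ρK ρ𝔤 →ₗ[GKRing G] GKRing.asModule σK σ𝔤,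
        (GKRing.asModuleEquiv σK σ𝔤) (φ ((GKRing.asModuleEquiv ρK ρ𝔤).symm v)) ∈ E' := by
  -- `E = span(K·v)`, finite-dimensional and `K`-stable
  let E : Submodule ℂ V := Submodule.span ℂ (Set.range fun k' : G.maximalCompact => ρK k' v)
  haveI : FiniteDimensional ℂ E := hV.kFinite v
  have hE : ∀ k : G.maximalCompact, E ≤ E.comap (ρK k) := span_orbit_le_comap' v
  have hvE : v ∈ E := Submodule.subset_span ⟨1, by simp⟩
  haveI : FiniteDimensional ℂ ((ρK.subrepresentation E hE).IntertwiningMap σK) :=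
    F0P3bStubT6dAdmissibleBridge.finiteDimensional_intertwiningMap_of_irreducibles σK hadm _ ↥E (ρK.subrepresentation E hE) le_rfl
  refine ⟨Representation.homRangeSum σK (ρK.subrepresentation E hE), Representation.finiteDimensional_homRangeSum, fun φ => ?_⟩
  -- `φ|_E` is a `K`-map `ρK|_E → σK`
  let f : (ρK.subrepresentation E hE).IntertwiningMap σK :=
    { toLinearMap := ((GKRing.asModuleEquiv σK σ𝔤).toLinearMap ∘ₗ φ.restrictScalars ℂ ∘ₗ
        (GKRing.asModuleEquiv ρK ρ𝔤).symm.toLinearMap) ∘ₗ E.subtype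
      isIntertwining' := fun k => LinearMap.ext fun e => by
        simp only [LinearMap.coe_comp, Function.comp_apply, Submodule.coe_subtype, LinearEquiv.coe_coe,
          LinearMap.coe_restrictScalars, Representation.subrepresentation_apply]
        have h1 := GKRing.map_actK G φ k ((GKRing.asModuleEquiv ρK ρ𝔤).symm (e : V))
        rw [GKRing.actK_asModule_apply, GKRing.actK_asModule_apply] at h1
        have h2 := congrArg (GKRing.asModuleEquiv σK σ𝔤) h1
        simpa using h2 }
  have hf : ∀ e : E, f e = (GKRing.asModuleEquiv σK σ𝔤) (φ ((GKRing.asModuleEquiv ρK ρ𝔤).symm (e : V))) := fun e => rfl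
  have := Representation.apply_mem_homRangeSum f ⟨v, hvE⟩
  rwa [hf] at this

variable (ρK ρ𝔤 σK σ𝔤) in
/-- **HEAD — a `(𝔤, K)`-module COGENERATED by an irreducible admissible `M` is `M`-ISOTYPIC**: if every non-zero `v ∈ V` is detected
by some `(𝔤, K)`-map `φ : V → M` with `φ v ≠ 0` (letter F1a's pointwise currency, ★ `DiscreteAutomorphicRep.ArchIsotypy`), `V` is a
`(𝔤, K)`-module (`K`-finite vectors) and `M` is irreducible and admissible, then
`isotypicComponent (GKRing G) V M = ⊤`: `V` is a sum of copies of `M` (§2 with `k = ℂ` and the finite-dimensional values of §3, then §1).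
[cite: BourbakiAlgebreVIII2012, VIII §4 n°1–2] [cite: KnappVogan1995, Ch. I §3] [cite: WallachRRG1, §3.3.1] -/
theorem isotypicComponent_eq_top_of_cogenerated (hV : IsGKModule G ρK ρ𝔤)
    (hirr : IsIrreducibleGK σK σ𝔤) (hadm : IsAdmissibleGK σK)
    (hcog : ∀ v : V, v ≠ 0 → ∃ φ : V →ₗ[ℂ] M,
      (∀ (k : G.maximalCompact) (w : V), φ (ρK k w) = σK k (φ w)) ∧
        (∀ (X : G.lie) (w : V), φ (ρ𝔤 X w) = σ𝔤 X (φ w)) ∧ φ v ≠ 0) :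
    isotypicComponent (GKRing G) (GKRing.asModule ρK ρ𝔤) (GKRing.asModule σK σ𝔤) = ⊤ := by
  haveI : IsSimpleModule (GKRing G) (GKRing.asModule σK σ𝔤) := (GKRing.isIrreducibleGK_iff_isSimpleModule_asModule σK σ𝔤).mp hirr
  refine isotypicComponent_eq_top_of_finitely_cogenerated fun m => ?_
  -- cogeneration by `GKRing G`-linear maps
  have hcog' : ∀ x : GKRing.asModule ρK ρ𝔤, x ≠ 0 →
      ∃ φ : GKRing.asModule ρK ρ𝔤 →ₗ[GKRing G] GKRing.asModule σK σ𝔤, φ x ≠ 0 := by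
    intro x hx
    obtain ⟨φ, hK, h𝔤, hφ⟩ := hcog ((GKRing.asModuleEquiv ρK ρ𝔤) x) (by simpa using hx)
    exact ⟨GKRing.mkLinearMapAsModule ρK ρ𝔤 σK σ𝔤 φ hK h𝔤, by simpa using hφ⟩
  -- finite-dimensional values at `m`
  obtain ⟨E', hE'fd, hE'⟩ := exists_finiteDimensional_forall_apply_mem (σ𝔤 := σ𝔤) hV hadm ((GKRing.asModuleEquiv ρK ρ𝔤) m)
  haveI := hE'fd
  let E'' : Submodule ℂ (GKRing.asModule σK σ𝔤) := E'.map (GKRing.asModuleEquiv σK σ𝔤).symm.toLinearMap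
  refine exists_finset_of_cogenerated (k := ℂ) hcog' m E'' fun φ => ?_
  rw [Submodule.mem_map_equiv, LinearEquiv.symm_symm]
  simpa using hE' φ

variable (ρK ρ𝔤 σK σ𝔤) in
/-- Corollary: such a `V` is a SEMISIMPLE `GKRing G`-module. [cite: BourbakiAlgebreVIII2012, VIII §4 n°1 Prop. 2] -/
theorem isSemisimpleModule_of_cogenerated (hV : IsGKModule G ρK ρ𝔤)
    (hirr : IsIrreducibleGK σK σ𝔤) (hadm : IsAdmissibleGK σK)
    (hcog : ∀ v : V, v ≠ 0 → ∃ φ : V →ₗ[ℂ] M,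
      (∀ (k : G.maximalCompact) (w : V), φ (ρK k w) = σK k (φ w)) ∧
        (∀ (X : G.lie) (w : V), φ (ρ𝔤 X w) = σ𝔤 X (φ w)) ∧ φ v ≠ 0) :
    IsSemisimpleModule (GKRing G) (GKRing.asModule ρK ρ𝔤) := by
  haveI : IsSimpleModule (GKRing G) (GKRing.asModule σK σ𝔤) := (GKRing.isIrreducibleGK_iff_isSimpleModule_asModule σK σ𝔤).mp hirr
  have htop := isotypicComponent_eq_top_of_cogenerated ρK ρ𝔤 σK σ𝔤 hV hirr hadm hcog
  let e : GKRing.asModule ρK ρ𝔤 ≃ₗ[GKRing G]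
      ↥(isotypicComponent (GKRing G) (GKRing.asModule ρK ρ𝔤) (GKRing.asModule σK σ𝔤)) := (LinearEquiv.ofTop _ htop).symm
  exact IsSemisimpleModule.congr (R := GKRing G) (N := GKRing.asModule ρK ρ𝔤)
    (M := ↥(isotypicComponent (GKRing G) (GKRing.asModule ρK ρ𝔤) (GKRing.asModule σK σ𝔤))) e

variable (ρK ρ𝔤 σK σ𝔤) in
/-- Corollary: such a `V` is ISOTYPIC OF TYPE `M` — every simple `GKRing G`-submodule of `V` is isomorphic to `M`.
[cite: BourbakiAlgebreVIII2012, VIII §4 n°1 Prop. 2] -/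
theorem isIsotypicOfType_of_cogenerated (hV : IsGKModule G ρK ρ𝔤)
    (hirr : IsIrreducibleGK σK σ𝔤) (hadm : IsAdmissibleGK σK)
    (hcog : ∀ v : V, v ≠ 0 → ∃ φ : V →ₗ[ℂ] M,
      (∀ (k : G.maximalCompact) (w : V), φ (ρK k w) = σK k (φ w)) ∧
        (∀ (X : G.lie) (w : V), φ (ρ𝔤 X w) = σ𝔤 X (φ w)) ∧ φ v ≠ 0) :
    IsIsotypicOfType (GKRing G) (GKRing.asModule ρK ρ𝔤) (GKRing.asModule σK σ𝔤) := by
  haveI : IsSimpleModule (GKRing G) (GKRing.asModule σK σ𝔤) := (GKRing.isIrreducibleGK_iff_isSimpleModule_asModule σK σ𝔤).mp hirr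
  exact IsIsotypicOfType.of_isotypicComponent_eq_top (isotypicComponent_eq_top_of_cogenerated ρK ρ𝔤 σK σ𝔤 hV hirr hadm hcog)

variable (ρK ρ𝔤 σK σ𝔤) in
/-- **OCCURRENCE — `M` is a SUBmodule of `V`**: under the same hypotheses and `V ≠ 0` there is an INJECTIVE `GKRing G`-linear map
`j : M → V` (a simple submodule of the semisimple `V ≠ 0` exists and is `≃ M`).  This is the input `j ≠ 0` of step R2
(★ `CommutingAlgebrasSimpleModuleSplit.exists_linearEquiv_of_surjective_algebraMap`). [cite: BourbakiAlgebreVIII2012, VIII §4 n°1] -/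
theorem exists_injective_of_cogenerated [Nontrivial V] (hV : IsGKModule G ρK ρ𝔤)
    (hirr : IsIrreducibleGK σK σ𝔤) (hadm : IsAdmissibleGK σK)
    (hcog : ∀ v : V, v ≠ 0 → ∃ φ : V →ₗ[ℂ] M,
      (∀ (k : G.maximalCompact) (w : V), φ (ρK k w) = σK k (φ w)) ∧
        (∀ (X : G.lie) (w : V), φ (ρ𝔤 X w) = σ𝔤 X (φ w)) ∧ φ v ≠ 0) :
    ∃ j : GKRing.asModule σK σ𝔤 →ₗ[GKRing G] GKRing.asModule ρK ρ𝔤, Function.Injective j := by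
  haveI : IsSimpleModule (GKRing G) (GKRing.asModule σK σ𝔤) := (GKRing.isIrreducibleGK_iff_isSimpleModule_asModule σK σ𝔤).mp hirr
  haveI : IsSemisimpleModule (GKRing G) (GKRing.asModule ρK ρ𝔤) := isSemisimpleModule_of_cogenerated ρK ρ𝔤 σK σ𝔤 hV hirr hadm hcog
  haveI : Nontrivial (GKRing.asModule ρK ρ𝔤) := inferInstanceAs (Nontrivial V)
  -- a simple submodule of the semisimple non-zero module
  obtain ⟨m, hm⟩ := (IsSemisimpleModule.eq_bot_or_exists_simple_le (⊤ : Submodule (GKRing G) (GKRing.asModule ρK ρ𝔤))).resolve_left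
    top_ne_bot
  obtain ⟨-, hsimple⟩ := hm
  haveI := hsimple
  obtain ⟨e⟩ := isIsotypicOfType_of_cogenerated ρK ρ𝔤 σK σ𝔤 hV hirr hadm hcog m
  exact ⟨m.subtype ∘ₗ e.symm.toLinearMap, fun a b h => e.symm.injective (Subtype.ext (by simpa using h))⟩

end GK

/-! ## §4 The instance for a discrete automorphic representation: letter F1a in isotypic currency -/

section Arch

open MeasureTheory

variable {K : Type} [Field K] [NumberField K] {𝒢 : AdelicGroupData K}
  {μ : Measure 𝒢.automorphicQuotient} [𝒢.IsAutomorphicMeasure μ]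
  {A : Type} [NormedCommRing A] [NormedAlgebra ℝ A] [NormedAlgebra ℚ A] [CompleteSpace A]
  [StarRing A] {N : Type} [Fintype N] [DecidableEq N]
  (P : DiscreteAutomorphicRep 𝒢 μ) (G : RealMatrixGroup A N) (ιG : G.carrier →* 𝒢.Adelic)

/-- **Letter F1a in ISOTYPIC currency.**  If `P.ArchIsotypy G ιG` (Harish-Chandra isotypy AS CONSUMED: cogeneration of the archimedean
module by an irreducible admissible `M`), then — under the fact's own standing hypotheses — there is an irreducible admissible
`(𝔤, K)`-module `M` with `isotypicComponent (GKRing G) (P.archModule G ιG) M = ⊤` (so `P.archModule G ιG` is a semisimple `M`-isotypic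
`GKRing G`-module) which moreover EMBEDS into `P.archModule G ιG` as soon as the latter is non-zero.
[cite: BourbakiAlgebreVIII2012, VIII §4 n°1–2] [cite: KnappVogan1995, Ch. I §3] -/
theorem exists_isotypic_of_archIsotypy (h : P.ArchIsotypy G ιG) [FiniteDimensional ℝ A] [StarModule ℝ A] [ContinuousStar A]
    (hA : IsStarFormallyReal A) (hG : G.HasCartanDecomposition) (hι : Continuous ιG)
    (hfac : ∃ C : Subgroup 𝒢.Adelic,
      (∀ (u : G.carrier) (c : 𝒢.Adelic), c ∈ C → ιG u * c = c * ιG u) ∧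
        ∀ g : 𝒢.Adelic, ∃ (u : G.carrier) (c : 𝒢.Adelic), c ∈ C ∧ g = ιG u * c) :
    ∃ (M : Type) (_ : AddCommGroup M) (_ : Module ℂ M) (σK : Representation ℂ G.maximalCompact M)
      (σ𝔤 : G.lie →ₗ⁅ℝ⁆ Module.End ℂ M),
      IsGKModule G σK σ𝔤 ∧ IsIrreducibleGK σK σ𝔤 ∧ IsAdmissibleGK σK ∧
        isotypicComponent (GKRing G) (GKRing.asModule (P.archRepK G ιG) (P.archRepLie G ιG hι)) (GKRing.asModule σK σ𝔤) = ⊤ ∧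
        (Nontrivial (P.archModule G ιG) →
          ∃ j : GKRing.asModule σK σ𝔤 →ₗ[GKRing G] GKRing.asModule (P.archRepK G ιG) (P.archRepLie G ιG hι),
            Function.Injective j) := by
  obtain ⟨M, _, _, σK, σ𝔤, hM, hirr, hadm, hcog⟩ := h hA hG hι hfac
  have hV : IsGKModule G (P.archRepK G ιG) (P.archRepLie G ιG hι) := P.isGKModule_archModule G ιG hι
  refine ⟨M, inferInstance, inferInstance, σK, σ𝔤, hM, hirr, hadm,
    isotypicComponent_eq_top_of_cogenerated _ _ σK σ𝔤 hV hirr hadm hcog, fun hnt => ?_⟩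
  haveI := hnt
  exact exists_injective_of_cogenerated _ _ σK σ𝔤 hV hirr hadm hcog

end Arch

end Summit.HodgeConjecture.HodgeConjecture.Cruxes.H413.F0P3ArchModuleIsotypic

end
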